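import Mathlib
import Summits.QuantumFields.YangMills.Theses.MirrorModularBoosts
import Summits.QuantumFields.YangMills.Theorems.MirrorModularBoostsPlanarSpectralConeConeChainFrames
import Literature.MathematicalPhysics.QuantumFieldTheory.OSReconstructionNoE1
import Literature.MathematicalPhysics.AQFT.OSAxiomsSchwinger
import HarnessLib

/-!
# `MirrorModularBoosts.MirrorTransport` (item stmt-QuantumFields-9667, support)

Informal statement. Let `S` be a one-species Schwinger family on `ℝ⁴`, invariant on `⁰𝒮` under a
linear isometry `g`, and let `R₀, R₁` be two frames (linear isometries) with `R₁ e₀ = g (R₀ e₀)`.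
If the pull-back `S ∘ linActMulti R₀` is reflection positive (E2 in the finite-list form of
`LabelledSchwingerFamily.IsReflectionPositive`), then so is `S ∘ linActMulti R₁`.

Proof (model-blind bookkeeping, Osterwalder–Schrader 1973 §2–§4 objects only). Put
`k := R₀⁻¹ g⁻¹ R₁`, an isometry fixing `e₀`; then
`linActMulti R₁ = linActMulti g ∘ linActMulti R₀ ∘ linActMulti k` (the action is a homomorphism).
On an OS pair `H = θFᵢ* ⊗ Fⱼ` (time-ordered `F`), `linActMulti R₀ (linActMulti k H) ∈ ⁰𝒮`, so the
`g`-invariance removes `g`; and since `k` fixes `e₀` it preserves the time coordinate and commutes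
with the time reflection, whence `linActMulti k (Fⱼ)` is again time-ordered and
`linActMulti k H = θ(linActMulti k Fᵢ)* ⊗ linActMulti k Fⱼ`: the E2 sum for `R₁` IS an E2 sum for
`R₀`.

References: K. Osterwalder, R. Schrader, Comm. Math. Phys. 31 (1973) 83–112, §2 (`f_{(a,R)}`, `Θ`),
§3 (E2); J. Glimm, A. Jaffe, Quantum Physics (1987), §6.1. The frame bookkeeping is folklore.
-/

noncomputable section

namespace Summit.QuantumFields.YangMills.Theorems

open Complex Set
open scoped InnerProductSpace ComplexConjugate
open Literature.MathematicalPhysics.QuantumLattice Literature.MathematicalPhysics.AQFT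
  Literature.MathematicalPhysics.QuantumFieldTheory
open Summit.QuantumFields.YangMills.Cruxes.PlanarSpectralCone.TwoMirrorLightconeSlots
  (isOffDiagonal_linActMulti_four mem_tsupport_of_mem_tsupport_linActMulti_four)

local notation "E4" => EuclideanSpace ℝ (Fin 4)

namespace MirrorTransport

/-! ## Isometries fixing the time axis -/

/-- The time reflection of `ℝ⁴` is the reflection in the hyperplane `e₀^⊥`: `θ v = v − 2v⁰ e₀`.
[folklore] -/
theorem timeReflection_eq_sub_smul (v : E4) :
    timeReflection 4 v = v - (2 * v 0) • EuclideanSpace.single (0 : Fin 4) (1 : ℝ) := by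
  ext i
  rw [timeReflection_apply, PiLp.sub_apply, PiLp.smul_apply, PiLp.single_apply]
  by_cases hi : i = 0
  · subst hi
    simp only [if_true, smul_eq_mul]
    ring
  · simp [hi]

/-- The time coordinate is the inner product with `e₀`: `v⁰ = ⟪e₀, v⟫`. [folklore] -/
theorem apply_zero_eq_inner (v : E4) :
    v 0 = ⟪EuclideanSpace.single (0 : Fin 4) (1 : ℝ), v⟫_ℝ := by
  rw [EuclideanSpace.inner_single_left]
  simp

/-- An isometry of `ℝ⁴` fixing `e₀` preserves the time coordinate. [folklore] -/
theorem apply_zero_of_map_single (k : E4 ≃ₗᵢ[ℝ] E4)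
    (hk : k (EuclideanSpace.single 0 1) = EuclideanSpace.single 0 1) (v : E4) :
    k v 0 = v 0 := by
  have h := k.inner_map_map (EuclideanSpace.single 0 1) v
  rw [hk] at h
  rw [apply_zero_eq_inner, apply_zero_eq_inner v, h]

/-- An isometry of `ℝ⁴` fixing `e₀` commutes with the time reflection. [folklore] -/
theorem map_timeReflection_of_map_single (k : E4 ≃ₗᵢ[ℝ] E4)
    (hk : k (EuclideanSpace.single 0 1) = EuclideanSpace.single 0 1) (v : E4) :
    k (timeReflection 4 v) = timeReflection 4 (k v) := by
  rw [timeReflection_eq_sub_smul, timeReflection_eq_sub_smul, map_sub, LinearIsometryEquiv.map_smul,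
    hk, apply_zero_of_map_single k hk]

/-- If `k` fixes `e₀` then so does `k⁻¹`. [folklore] -/
theorem symm_map_single (k : E4 ≃ₗᵢ[ℝ] E4)
    (hk : k (EuclideanSpace.single 0 1) = EuclideanSpace.single 0 1) :
    k.symm (EuclideanSpace.single 0 1) = EuclideanSpace.single 0 1 := by
  conv_lhs => rw [← hk]
  rw [LinearIsometryEquiv.symm_apply_apply]

/-! ## Transport of the OS data by an isometry fixing `e₀` -/

/-- An isometry fixing `e₀` preserves time-ordering of test functions:
`supp (linActMulti k F) = k · supp F` and `(k⁻¹ x)⁰ = x⁰`. [folklore] -/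
theorem isTimeOrdered_linActMulti_of_map_single (k : E4 ≃ₗᵢ[ℝ] E4)
    (hk : k (EuclideanSpace.single 0 1) = EuclideanSpace.single 0 1) {n : ℕ}
    {F : SchwartzMap (Fin n → E4) ℂ} (hF : IsTimeOrdered F) :
    IsTimeOrdered (linActMulti k F) := by
  intro x hx
  obtain ⟨hpos, hmono⟩ := hF (mem_tsupport_of_mem_tsupport_linActMulti_four k F hx)
  have h0 : ∀ i, k.symm (x i) 0 = x i 0 := fun i =>
    apply_zero_of_map_single k.symm (symm_map_single k hk) (x i)
  refine ⟨fun i => ?_, fun i j hij => ?_⟩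
  · have := hpos i
    rwa [h0] at this
  · have := hmono hij
    simp only [h0] at this
    exact this

/-- The OS adjoint commutes with the action of an isometry fixing `e₀`:
`θ(F ∘ k⁻¹)* = (θF*) ∘ k⁻¹`, because `k⁻¹ θ = θ k⁻¹`. [folklore] -/
theorem osAdjoint_linActMulti_of_map_single (k : E4 ≃ₗᵢ[ℝ] E4)
    (hk : k (EuclideanSpace.single 0 1) = EuclideanSpace.single 0 1) {n : ℕ}
    (F : SchwartzMap (Fin n → E4) ℂ) :
    osAdjoint (linActMulti k F) = linActMulti k (osAdjoint F) := by
  ext x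
  simp only [osAdjoint_apply, linActMulti_apply,
    map_timeReflection_of_map_single k.symm (symm_map_single k hk)]

/-- OS tensor witnesses are transported: if `H = θFᵢ* ⊗ G` then
`linActMulti k H = θ(linActMulti k F)* ⊗ linActMulti k G` for `k` fixing `e₀`. [folklore] -/
theorem isAppendTensorOf_linActMulti_of_map_single (k : E4 ≃ₗᵢ[ℝ] E4)
    (hk : k (EuclideanSpace.single 0 1) = EuclideanSpace.single 0 1) {n m : ℕ}
    {H : SchwartzMap (Fin (n + m) → E4) ℂ} {F : SchwartzMap (Fin n → E4) ℂ}
    {G : SchwartzMap (Fin m → E4) ℂ} (hH : IsAppendTensorOf H (osAdjoint F) G) :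
    IsAppendTensorOf (linActMulti k H) (osAdjoint (linActMulti k F)) (linActMulti k G) := by
  intro x
  rw [osAdjoint_linActMulti_of_map_single k hk, linActMulti_apply, hH, linActMulti_apply,
    linActMulti_apply]
  rfl

/-- An OS tensor witness `H = θF* ⊗ G` of time-ordered `F, G` lies in `⁰𝒮`, and so does each of
its pull-backs `linActMulti L H`. [folklore] -/
theorem isOffDiagonal_linActMulti_of_isAppendTensorOf {n m : ℕ}
    {H : SchwartzMap (Fin (n + m) → E4) ℂ} {F : SchwartzMap (Fin n → E4) ℂ}
    {G : SchwartzMap (Fin m → E4) ℂ} (hF : IsTimeOrdered F) (hG : IsTimeOrdered G)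
    (hH : IsAppendTensorOf H (osAdjoint F) G) (L : E4 ≃ₗᵢ[ℝ] E4) :
    IsOffDiagonal (linActMulti L H) := by
  have hHeq : H = (osAdjoint F).appendTensor G := by
    ext x
    rw [hH x, SchwartzMap.appendTensor_apply]
  rw [hHeq]
  exact isOffDiagonal_linActMulti_four
    (OSReconstructionNoE1.isOffDiagonal_appendTensor_osAdjoint hF hG) L

/-- The diagonal action is a homomorphism: with `k := R₀⁻¹ g⁻¹ R₁`,
`linActMulti R₁ = linActMulti g ∘ linActMulti R₀ ∘ linActMulti k`. [folklore] -/
theorem linActMulti_frame_factor (g R₀ R₁ : E4 ≃ₗᵢ[ℝ] E4) {n : ℕ}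
    (H : SchwartzMap (Fin n → E4) ℂ) :
    linActMulti R₁ H =
      linActMulti g (linActMulti R₀ (linActMulti ((R₁.trans g.symm).trans R₀.symm) H)) := by
  ext x
  simp only [linActMulti_apply]
  congr 1
  funext i
  simp

end MirrorTransport

/-! ## The item -/

open MirrorTransport in
/-- **`MirrorTransport`** (route `MirrorModularBoosts`, item stmt-QuantumFields-9667): if a
one-species family `S` on `ℝ⁴` is invariant on `⁰𝒮` under a linear isometry `g` and its pull-back
by the frame `R₀` is reflection positive, then its pull-back by any frame `R₁` with
`R₁ e₀ = g (R₀ e₀)` is reflection positive. With `k := R₀⁻¹ g⁻¹ R₁` (fixing `e₀`):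
`linActMulti R₁ = linActMulti g ∘ linActMulti R₀ ∘ linActMulti k`; `g` drops out on `⁰𝒮`; and the
`R₁`-E2 sum of the OS data `(Fⱼ, Hᵢⱼ)` is the `R₀`-E2 sum of the transported OS data
`(linActMulti k Fⱼ, linActMulti k Hᵢⱼ)`. [folklore] -/
theorem mirrorTransport_proof :
    Summit.QuantumFields.YangMills.Theses.MirrorModularBoosts.MirrorTransport := by
  dsimp only [Summit.QuantumFields.YangMills.Theses.MirrorModularBoosts.MirrorTransport]
  intro S g R₀ R₁ hg he hRP N deg lab F hF H hH
  set k : E4 ≃ₗᵢ[ℝ] E4 := (R₁.trans g.symm).trans R₀.symm with hk_def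
  have hk : k (EuclideanSpace.single 0 1) = EuclideanSpace.single 0 1 := by
    simp [hk_def, he]
  have key : ∀ i j, S (deg i + deg j) (linActMulti R₁ (H i j)) =
      S (deg i + deg j) (linActMulti R₀ (linActMulti k (H i j))) := by
    intro i j
    rw [linActMulti_frame_factor g R₀ R₁ (H i j)]
    exact hg _ _ (isOffDiagonal_linActMulti_of_isAppendTensorOf
      (isTimeOrdered_linActMulti_of_map_single k hk (hF i))
      (isTimeOrdered_linActMulti_of_map_single k hk (hF j))
      (isAppendTensorOf_linActMulti_of_map_single k hk (hH i j)) R₀)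
  have h0 := hRP N deg lab (fun j => linActMulti k (F j))
    (fun j => isTimeOrdered_linActMulti_of_map_single k hk (hF j))
    (fun i j => linActMulti k (H i j))
    (fun i j => isAppendTensorOf_linActMulti_of_map_single k hk (hH i j))
  simp only [SchwingerFamily.toLabelled_apply, ContinuousLinearMap.comp_apply] at h0 ⊢
  simp only [key]
  exact h0

end Summit.QuantumFields.YangMills.Theorems
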